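import Summits.ValiantsHypothesis.ValiantsHypothesis.Theorems.SymPencilPerFourLowRankSeven

/-!
# Route `SymPencil` — six-dimensional singular subspaces: a detecting pair of rows with a zero
# column is a `2 × 3` block (brick (D2) of the `(10, 6)` cell of
# `Cruxes/SdcSuperquadratic/NEXT-RUNG-25.md`; `--supports` stmt-ValiantsHypothesis-5674)

**Theorem** (`rows_eq_zero_of_detecting01_col3`).  Over a field of characteristic `0`, let `V`
be a `6`-dimensional space of `4 × 4` matrices on which all `3 × 3` subpermanents vanish,
detected by the rows `0, 1` (an element with rows `0, 1` zero is zero), and with the cells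
`(0, 3), (1, 3)` identically zero.  Then the rows `2, 3` vanish identically on `V`: `V` is the
`2 × 3` block on rows `0, 1` and columns `0, 1, 2`.

Proof.  `V → (rows 0, 1 on the columns 0, 1, 2)` is injective (detection) between spaces of
dimension `6`, hence bijective; let `a_k, b_k ∈ V` have rows `(e_k, 0)`, `(0, e_k)` there.  The
`3 × 3` subpermanent on the rows `(0, 1, r)` (`r = 2, 3`) and the columns `(k, k', j)` of
`a_k + t b_{k'}` equals `t · (a_k + t b_{k'})_{rj}`, so the rows `r` of `a_k`, `b_k` vanish off the
column `k`; on `a_k + a_{k'} + b_j` (`{k, k', j} = {0, 1, 2}`) it equals the sum of the two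
diagonal entries `(a_k)_{rk} + (a_{k'})_{rk'}`, so these vanish too (characteristic `≠ 2`);
similarly for the `b_k`.  Every element of `V` is a combination of the `a_k, b_k` (detection).

Honest framing: a lemma towards T6″; `sdc(per_4) ≥ 25` is the tree's value; the crux
`SdcSuperquadratic` and `VP ≠ VNP` are untouched.  No definitions, no named facts. [folklore]
-/

noncomputable section

-- single-conjunct layout: Sub = Summit, duplicated namespace component intended
set_option linter.dupNamespace false

namespace Summit.ValiantsHypothesis.ValiantsHypothesis.Theorems.SymPencilPerFourSixDimGraph

open Matrix MvPolynomial Finset Module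
open Literature.Computability.AlgebraicComplexity
open Literature.Computability.AlgebraicComplexity.AlperBogartVelasco

variable {K : Type*} [Field K]

/-- The `3 × 3` subpermanent on the rows `(0, 1, r)` and the columns `(k, k', j)`, expanded along
the first row. [folklore] -/
theorem subperm_rows01_eq (x : Fin 4 × Fin 4 → K) (r k k' j : Fin 4) :
    ((Matrix.of fun i j => x (i, j)).submatrix ![0, 1, r] ![k, k', j]).permanent =
      x (0, k) * (x (1, k') * x (r, j) + x (1, j) * x (r, k')) +
      x (0, k') * (x (1, k) * x (r, j) + x (1, j) * x (r, k)) +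
      x (0, j) * (x (1, k) * x (r, k') + x (1, k') * x (r, k)) := by
  rw [Matrix.permanent_fin_three_row]
  simp [Matrix.submatrix_apply]

/-- **Detecting rows `0, 1` with the column `3` zero on them: the rows `2, 3` vanish** (dimension
`6`, all `3 × 3` subpermanents vanishing).  See the module docstring. [folklore] -/
theorem rows_eq_zero_of_detecting01_col3 [CharZero K] (V : Submodule K (Fin 4 × Fin 4 → K))
    (hV3 : ∀ x ∈ V, ∀ (r c : Fin 3 → Fin 4), Function.Injective r → Function.Injective c →
      ((Matrix.of fun i j => x (i, j)).submatrix r c).permanent = 0)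
    (h6 : finrank K V = 6)
    (hdet : ∀ x ∈ V, (∀ j, x (0, j) = 0) → (∀ j, x (1, j) = 0) → x = 0)
    (hcol : ∀ x ∈ V, x (0, 3) = 0 ∧ x (1, 3) = 0) :
    ∀ x ∈ V, ∀ r : Fin 4, r ≠ 0 → r ≠ 1 → ∀ j, x (r, j) = 0 := by
  classical
  -- the projection onto the `2 × 3` pattern is bijective
  let G : (Fin 4 × Fin 4 → K) →ₗ[K] ((Fin 3 → K) × (Fin 3 → K)) :=
    LinearMap.prod (LinearMap.pi fun m : Fin 3 => LinearMap.proj ((0 : Fin 4), (Fin.castSucc m : Fin 4)))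
      (LinearMap.pi fun m : Fin 3 => LinearMap.proj ((1 : Fin 4), (Fin.castSucc m : Fin 4)))
  have hG1 : ∀ x m, (G x).1 m = x (0, Fin.castSucc m) := fun _ _ => rfl
  have hG2 : ∀ x m, (G x).2 m = x (1, Fin.castSucc m) := fun _ _ => rfl
  have col_cases : ∀ j : Fin 4, j ≠ 3 → ∃ m : Fin 3, j = Fin.castSucc m := by
    intro j hj
    rcases Fin.eq_castSucc_or_eq_last j with ⟨m, hm⟩ | h
    · exact ⟨m, hm⟩
    · exact absurd h hj
  have hker : (V ⊓ LinearMap.ker G : Submodule K _) = ⊥ := by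
    rw [eq_bot_iff]
    intro x hx
    rw [Submodule.mem_inf, LinearMap.mem_ker] at hx
    rw [Submodule.mem_bot]
    refine hdet x hx.1 (fun j => ?_) (fun j => ?_)
    · by_cases hj : j = 3
      · rw [hj]; exact (hcol x hx.1).1
      · obtain ⟨m, rfl⟩ := col_cases j hj
        exact (hG1 x m).symm.trans (by rw [hx.2]; rfl)
    · by_cases hj : j = 3
      · rw [hj]; exact (hcol x hx.1).2
      · obtain ⟨m, rfl⟩ := col_cases j hj
        exact (hG2 x m).symm.trans (by rw [hx.2]; rfl)
  have htop : V.map G = ⊤ := by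
    apply Submodule.eq_top_of_finrank_eq
    have h := finrank_eq_finrank_map_add_finrank_inf_ker V G
    rw [hker, finrank_bot, add_zero] at h
    rw [← h, h6, Module.finrank_prod, finrank_fintype_fun_eq_card, Fintype.card_fin]
  have hsurj : ∀ α β : Fin 3 → K, ∃ x ∈ V, (∀ m, x (0, Fin.castSucc m) = α m) ∧
      (∀ m, x (1, Fin.castSucc m) = β m) := by
    intro α β
    have hv : (α, β) ∈ V.map G := by rw [htop]; exact Submodule.mem_top
    obtain ⟨x, hxV, hGx⟩ := hv
    refine ⟨x, hxV, fun m => ?_, fun m => ?_⟩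
    · exact (hG1 x m).symm.trans (by rw [hGx])
    · exact (hG2 x m).symm.trans (by rw [hGx])
  -- the basis preimages `a k` (rows `(e_k, 0)`) and `b k` (rows `(0, e_k)`)
  choose a haV ha0 ha1 using fun k : Fin 3 => hsurj (Pi.single k 1) 0
  choose b hbV hb0 hb1 using fun k : Fin 3 => hsurj 0 (Pi.single k 1)
  -- entries of rows `0, 1` of the test elements
  have cs3 : ∀ k : Fin 3, (Fin.castSucc k : Fin 4) ≠ 3 := fun k => (Fin.castSucc_lt_last k).ne
  have csinj : ∀ k m : Fin 3, (Fin.castSucc k : Fin 4) = Fin.castSucc m → k = m :=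
    fun k m h => Fin.castSucc_injective _ h
  have a0 : ∀ k : Fin 3, ∀ j : Fin 4, a k (0, j) = if j = Fin.castSucc k then 1 else 0 := by
    intro k j
    by_cases hj : j = 3
    · rw [hj, (hcol _ (haV k)).1, if_neg (cs3 k).symm]
    · obtain ⟨m, rfl⟩ := col_cases j hj
      rw [ha0, Pi.single_apply]
      by_cases hmk : m = k
      · rw [if_pos hmk, if_pos (by rw [hmk])]
      · rw [if_neg hmk, if_neg (fun h => hmk (csinj m k h))]
  have a1 : ∀ k : Fin 3, ∀ j : Fin 4, a k (1, j) = 0 := by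
    intro k j
    by_cases hj : j = 3
    · rw [hj]; exact (hcol _ (haV k)).2
    · obtain ⟨m, rfl⟩ := col_cases j hj
      rw [ha1]; rfl
  have b1 : ∀ k : Fin 3, ∀ j : Fin 4, b k (1, j) = if j = Fin.castSucc k then 1 else 0 := by
    intro k j
    by_cases hj : j = 3
    · rw [hj, (hcol _ (hbV k)).2, if_neg (cs3 k).symm]
    · obtain ⟨m, rfl⟩ := col_cases j hj
      rw [hb1, Pi.single_apply]
      by_cases hmk : m = k
      · rw [if_pos hmk, if_pos (by rw [hmk])]
      · rw [if_neg hmk, if_neg (fun h => hmk (csinj m k h))]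
  have b0 : ∀ k : Fin 3, ∀ j : Fin 4, b k (0, j) = 0 := by
    intro k j
    by_cases hj : j = 3
    · rw [hj]; exact (hcol _ (hbV k)).1
    · obtain ⟨m, rfl⟩ := col_cases j hj
      rw [hb0]; rfl
  -- injectivity of the index vectors
  have rinj : ∀ r : Fin 4, r ≠ 0 → r ≠ 1 → Function.Injective (![0, 1, r] : Fin 3 → Fin 4) := by
    intro r hr0 hr1 i i' h
    fin_cases i <;> fin_cases i'
    all_goals (first | rfl | (exfalso; simp at h))
    all_goals first | exact hr0 h | exact hr0 h.symm | exact hr1 h | exact hr1 h.symm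
  have cinj : ∀ k k' j : Fin 4, k ≠ k' → j ≠ k → j ≠ k' →
      Function.Injective (![k, k', j] : Fin 3 → Fin 4) := by
    intro k k' j h1 h2 h3 i i' h
    fin_cases i <;> fin_cases i'
    all_goals (first | rfl | (exfalso; simp at h))
    all_goals first | exact h1 h | exact h1 h.symm | exact h2 h | exact h2 h.symm | exact h3 h | exact h3 h.symm
  -- Step 1: off-diagonal vanishing of the rows `r` of `a k` and `b k'`
  have step1 : ∀ r : Fin 4, r ≠ 0 → r ≠ 1 → ∀ k k' : Fin 3, k ≠ k' → ∀ j : Fin 4,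
      j ≠ Fin.castSucc k → j ≠ Fin.castSucc k' → a k (r, j) = 0 ∧ b k' (r, j) = 0 := by
    intro r hr0 hr1 k k' hkk' j hjk hjk'
    have hck : (Fin.castSucc k : Fin 4) ≠ Fin.castSucc k' := fun h => hkk' (csinj k k' h)
    have key : ∀ t : K, t * (a k (r, j) + t * b k' (r, j)) = 0 := by
      intro t
      have hx : a k + t • b k' ∈ V := V.add_mem (haV k) (V.smul_mem t (hbV k'))
      have h := hV3 _ hx ![0, 1, r] ![Fin.castSucc k, Fin.castSucc k', j] (rinj r hr0 hr1)
        (cinj _ _ _ hck hjk hjk')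
      rw [subperm_rows01_eq] at h
      simp only [Pi.add_apply, Pi.smul_apply, smul_eq_mul, a0, a1, b0, b1,
        if_true, if_false, hck, hck.symm, hjk, hjk'] at h
      linear_combination h
    have h1 := key 1
    have h2 := key 2
    constructor
    · linear_combination 2 * h1 - (1 / 2 : K) * h2
    · linear_combination (1 / 2 : K) * h2 - h1
  -- consequences: `a k (r, j) = 0` and `b k (r, j) = 0` for every `j ≠ castSucc k`
  have third : ∀ k m : Fin 3, ∃ n : Fin 3, n ≠ k ∧ n ≠ m := by decide
  have offA : ∀ r : Fin 4, r ≠ 0 → r ≠ 1 → ∀ k : Fin 3, ∀ j : Fin 4, j ≠ Fin.castSucc k →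
      a k (r, j) = 0 := by
    intro r hr0 hr1 k j hjk
    obtain ⟨k', hk'k, hjk'⟩ : ∃ k' : Fin 3, k' ≠ k ∧ j ≠ Fin.castSucc k' := by
      by_cases hj3 : j = 3
      · obtain ⟨k', hk', -⟩ := third k k
        exact ⟨k', hk', by rw [hj3]; exact (cs3 k').symm⟩
      · obtain ⟨m, rfl⟩ := col_cases j hj3
        obtain ⟨n, hnk, hnm⟩ := third k m
        exact ⟨n, hnk, fun h => hnm (csinj m n h).symm⟩
    exact (step1 r hr0 hr1 k k' hk'k.symm j hjk hjk').1
  have offB : ∀ r : Fin 4, r ≠ 0 → r ≠ 1 → ∀ k : Fin 3, ∀ j : Fin 4, j ≠ Fin.castSucc k →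
      b k (r, j) = 0 := by
    intro r hr0 hr1 k j hjk
    obtain ⟨k', hk'k, hjk'⟩ : ∃ k' : Fin 3, k' ≠ k ∧ j ≠ Fin.castSucc k' := by
      by_cases hj3 : j = 3
      · obtain ⟨k', hk', -⟩ := third k k
        exact ⟨k', hk', by rw [hj3]; exact (cs3 k').symm⟩
      · obtain ⟨m, rfl⟩ := col_cases j hj3
        obtain ⟨n, hnk, hnm⟩ := third k m
        exact ⟨n, hnk, fun h => hnm (csinj m n h).symm⟩
    exact (step1 r hr0 hr1 k' k hk'k j hjk' hjk).2
  -- Step 2: the diagonal entries, through the pair sums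
  have pairA : ∀ r : Fin 4, r ≠ 0 → r ≠ 1 → ∀ k k' : Fin 3, k ≠ k' →
      a k (r, Fin.castSucc k) + a k' (r, Fin.castSucc k') = 0 := by
    intro r hr0 hr1 k k' hkk'
    obtain ⟨n, hnk, hnk'⟩ := third k k'
    have hck : (Fin.castSucc k : Fin 4) ≠ Fin.castSucc k' := fun h => hkk' (csinj k k' h)
    have hnck : (Fin.castSucc n : Fin 4) ≠ Fin.castSucc k := fun h => hnk (csinj n k h)
    have hnck' : (Fin.castSucc n : Fin 4) ≠ Fin.castSucc k' := fun h => hnk' (csinj n k' h)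
    have hx : a k + a k' + b n ∈ V := V.add_mem (V.add_mem (haV k) (haV k')) (hbV n)
    have h := hV3 _ hx ![0, 1, r] ![Fin.castSucc k, Fin.castSucc k', Fin.castSucc n]
      (rinj r hr0 hr1) (cinj _ _ _ hck hnck hnck')
    rw [subperm_rows01_eq] at h
    simp only [Pi.add_apply, a0, a1, b0, b1, if_true, if_false, hck, hck.symm,
      hnck, hnck', hnck.symm, hnck'.symm] at h
    have e1 := offA r hr0 hr1 k (Fin.castSucc k') hck.symm
    have e2 := offA r hr0 hr1 k' (Fin.castSucc k) hck
    have e3 := offB r hr0 hr1 n (Fin.castSucc k) hnck.symm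
    have e4 := offB r hr0 hr1 n (Fin.castSucc k') hnck'.symm
    linear_combination h - e1 - e2 - e3 - e4
  have pairB : ∀ r : Fin 4, r ≠ 0 → r ≠ 1 → ∀ k k' : Fin 3, k ≠ k' →
      b k (r, Fin.castSucc k) + b k' (r, Fin.castSucc k') = 0 := by
    intro r hr0 hr1 k k' hkk'
    obtain ⟨n, hnk, hnk'⟩ := third k k'
    have hck : (Fin.castSucc k : Fin 4) ≠ Fin.castSucc k' := fun h => hkk' (csinj k k' h)
    have hnck : (Fin.castSucc n : Fin 4) ≠ Fin.castSucc k := fun h => hnk (csinj n k h)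
    have hnck' : (Fin.castSucc n : Fin 4) ≠ Fin.castSucc k' := fun h => hnk' (csinj n k' h)
    have hx : a n + b k + b k' ∈ V := V.add_mem (V.add_mem (haV n) (hbV k)) (hbV k')
    have h := hV3 _ hx ![0, 1, r] ![Fin.castSucc k, Fin.castSucc k', Fin.castSucc n]
      (rinj r hr0 hr1) (cinj _ _ _ hck hnck hnck')
    rw [subperm_rows01_eq] at h
    simp only [Pi.add_apply, a0, a1, b0, b1, if_true, if_false, hck, hck.symm,
      hnck, hnck', hnck.symm, hnck'.symm] at h
    have e1 := offB r hr0 hr1 k (Fin.castSucc k') hck.symm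
    have e2 := offB r hr0 hr1 k' (Fin.castSucc k) hck
    have e3 := offA r hr0 hr1 n (Fin.castSucc k) hnck.symm
    have e4 := offA r hr0 hr1 n (Fin.castSucc k') hnck'.symm
    linear_combination h - e1 - e2 - e3 - e4
  have others : ∀ k : Fin 3, ∃ k' k'' : Fin 3, k' ≠ k ∧ k'' ≠ k ∧ k' ≠ k'' := by decide
  have diagA : ∀ r : Fin 4, r ≠ 0 → r ≠ 1 → ∀ k : Fin 3, a k (r, Fin.castSucc k) = 0 := by
    intro r hr0 hr1 k
    obtain ⟨k', k'', h1, h2, h3⟩ := others k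
    have p1 := pairA r hr0 hr1 k k' h1.symm
    have p2 := pairA r hr0 hr1 k k'' h2.symm
    have p3 := pairA r hr0 hr1 k' k'' h3
    linear_combination (p1 + p2 - p3) / 2
  have diagB : ∀ r : Fin 4, r ≠ 0 → r ≠ 1 → ∀ k : Fin 3, b k (r, Fin.castSucc k) = 0 := by
    intro r hr0 hr1 k
    obtain ⟨k', k'', h1, h2, h3⟩ := others k
    have p1 := pairB r hr0 hr1 k k' h1.symm
    have p2 := pairB r hr0 hr1 k k'' h2.symm
    have p3 := pairB r hr0 hr1 k' k'' h3
    linear_combination (p1 + p2 - p3) / 2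
  have allA : ∀ r : Fin 4, r ≠ 0 → r ≠ 1 → ∀ k : Fin 3, ∀ j : Fin 4, a k (r, j) = 0 := by
    intro r hr0 hr1 k j
    by_cases h : j = Fin.castSucc k
    · rw [h]; exact diagA r hr0 hr1 k
    · exact offA r hr0 hr1 k j h
  have allB : ∀ r : Fin 4, r ≠ 0 → r ≠ 1 → ∀ k : Fin 3, ∀ j : Fin 4, b k (r, j) = 0 := by
    intro r hr0 hr1 k j
    by_cases h : j = Fin.castSucc k
    · rw [h]; exact diagB r hr0 hr1 k
    · exact offB r hr0 hr1 k j h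
  -- Step 3: every element of `V` is a combination of the `a k, b k`
  intro x hx r hr0 hr1 j
  set x' := x - (∑ m, x (0, Fin.castSucc m) • a m + ∑ m, x (1, Fin.castSucc m) • b m) with hx'
  have hx'V : x' ∈ V := by
    refine V.sub_mem hx (V.add_mem ?_ ?_)
    · exact Submodule.sum_mem _ fun m _ => V.smul_mem _ (haV m)
    · exact Submodule.sum_mem _ fun m _ => V.smul_mem _ (hbV m)
  have hsum : ∀ p : Fin 4 × Fin 4,
      (∑ m, x (0, Fin.castSucc m) • a m + ∑ m, x (1, Fin.castSucc m) • b m) p =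
        ∑ m, x (0, Fin.castSucc m) * a m p + ∑ m, x (1, Fin.castSucc m) * b m p := by
    intro p
    simp only [Pi.add_apply, Finset.sum_apply, Pi.smul_apply, smul_eq_mul]
  have hx'0 : x' = 0 := by
    refine hdet x' hx'V (fun j => ?_) (fun j => ?_)
    · rw [hx', Pi.sub_apply, hsum]
      simp only [a0, b0, mul_zero, Finset.sum_const_zero, add_zero]
      by_cases hj : j = 3
      · rw [hj, (hcol x hx).1]
        simp [(cs3 _).symm]
      · obtain ⟨m, rfl⟩ := col_cases j hj
        rw [Finset.sum_eq_single m]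
        · simp
        · intro m' _ hm'
          rw [if_neg (fun h => hm' (csinj m m' h).symm), mul_zero]
        · intro h; exact absurd (Finset.mem_univ m) h
    · rw [hx', Pi.sub_apply, hsum]
      simp only [a1, b1, mul_zero, Finset.sum_const_zero, zero_add]
      by_cases hj : j = 3
      · rw [hj, (hcol x hx).2]
        simp [(cs3 _).symm]
      · obtain ⟨m, rfl⟩ := col_cases j hj
        rw [Finset.sum_eq_single m]
        · simp
        · intro m' _ hm'
          rw [if_neg (fun h => hm' (csinj m m' h).symm), mul_zero]
        · intro h; exact absurd (Finset.mem_univ m) h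
  have h := congr_fun hx'0 (r, j)
  rw [hx', Pi.sub_apply, hsum, Pi.zero_apply] at h
  simp only [allA r hr0 hr1, allB r hr0 hr1, mul_zero, Finset.sum_const_zero, add_zero,
    sub_zero] at h
  exact h

end Summit.ValiantsHypothesis.ValiantsHypothesis.Theorems.SymPencilPerFourSixDimGraph

end
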